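import Literature.AnabelianGeometry.SemiGraphs.SgACoveringHomCanPoints
import Literature.AnabelianGeometry.SemiGraphs.TemperedCoveringsProofs
import HarnessLib

/-!
# [SemiAnbd] Def. 2.2 (i) ⇒ Def. 3.5 (i)/(ii) for print's constructed covering: `𝒢_A → ℋ`, read on
# profinite presentations, is isomorphic over `ℋ` to the covering of the finite object `toCovObj A` of
# `B^cov(ℋ)` — hence a TEMPERED covering (bridge brick L1d-align, definition layer)

Mochizuki, *Semi-graphs of anabelioids*, Publ. RIMS **42** (2006), Def. 2.2 (i) p. 23 (the finite étale
covering attached to `G' ∈ Ob(B(𝒢))`), Def. 3.5 (i)/(ii) p. 37 ("coverings of semi-graphs of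
anabelioids that arise from finite objects of `B^cov(G)` determine 'finite étale coverings'";
"`B(G) ↪ B^temp(G)`") (kurims `paper:url-f33ace170ff4`). [cite: MochizukiSemiAnbd2006, Def 3.5(i) p.37]

Closing brick of the (R1) bridge law L1 «finite étale ⇒ tempered» for PRINT'S CONSTRUCTED COVERINGS
(HOME/staging/L3/L3-t3/R1-BRIDGE-SHAPES.md §4; interface owner abc-iut-L3-t3), over
`SgACoveringHomCanPoints.lean` (canonical point system, (PS1), (PS2), the aligned conjugator) and
L4-t17's point alignment `alignIso_point` (`CoveringHomCanPointAlignment.lean`):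

* `BObj.ρ_conjCan_glue_zCan` — **the point clause of (PS3)**: the aligned conjugator carries the glued
  canonical edge point to the canonical vertex point (transport back along the paths of `ℋ`, across
  the 2-cell `φ_b⁻¹`, forth along the paths of `𝒢_A`; one-point fibres; naturality along `P ↪ S_v`);
* `BObj.pointAligned_can` — (PS3) for `coveringHomCan A` at the canonical points;
* `BObj.isoOverCan A : Hom.IsoOver (coveringHomCan A).toProfinite (toCovObj A).coveringHom` — **THE
  ISOMORPHISM OVER `ℋ`** (`CovObj.pointIsoOver`);
* `BObj.isTempered_toCovObj`, `BObj.exists_isTempered_isoOver_can` — for `ℋ` connected and countable,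
  `toCovObj A` is tempered (`FiniteIsTempered_holds`) and `𝒢_A → ℋ` is a tempered covering on
  profinite presentations (the body of `SgA.IsTemperedCoveringVia` for `coveringHomCan A`).

The `SgA`-level corollary (the arrow of print's constructed covering in the §§4–5 ambient category
`IsTemperedCoveringOf`) is the companion `SgACoveringArrowTempered.lean`.  Nothing of the paper is
asserted; no side taken on [IUTchIII] Cor. 3.12.
-/

noncomputable section

namespace Literature.AnabelianGeometry.SemiGraphs

open CategoryTheory CategoryTheory.Limits CategoryTheory.PreGaloisCategory
open Literature.AnabelianGeometry.Anabelioids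

universe u

namespace SemiGraphOfAnabelioids

namespace BObj

variable {ℋ : SemiGraphOfAnabelioids.{u, u, u}} (A : ℋ.BObj)

/-! ### The profinite point alignment of print's constructed covering -/

section PointAlignment

variable (bc : A.fibreData.total.Branch) (vc : A.fibreData.total.Vertex)
  (h' : A.fibreData.total.abuts bc = some vc)

/-- `Q ↪ T_e` followed by `ψ_b⁻¹` is `ι_Q` followed by `b^*(P ↪ S_v)` (from `inclOfLE_comp`).
[cite: MochizukiSemiAnbd2006, Def. 2.2(i) p.23] -/
theorem brComp_arrow_comp_ψ_inv :
    (A.brComp bc).1.arrow ≫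
        (A.ψ (A.fibreData.proj.branchMap bc) (A.fibreData.proj.vertexMap vc) (abuts_fst h')).inv =
      A.inclOfLE (abuts_fst h') (A.vComp vc).1 (A.brComp bc).1 (brComp_le_branchImage h') ≫
        (ℋ.pull _ _ (abuts_fst h')).pullback.map (A.vComp vc).1.arrow := by
  rw [← A.inclOfLE_comp (abuts_fst h') (A.vComp vc).1 (A.brComp bc).1 (brComp_le_branchImage h'),
    Category.assoc, Category.assoc, Iso.hom_inv_id, Category.comp_id]

/-- L4-t17's point alignment for `coveringHomCan`, UNFOLDED at the canonical basepoints and the chosen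
paths: across the 2-cell `φ_b⁻¹` and forth along `α_𝒢`, the canonical edge point (pushed along `ι_Q`)
goes to the canonical vertex point (one-point fibres). [cite: MochizukiSemiAnbd2006, Def. 2.2(i) p.23] -/
theorem alignIso_point_can :
    (A.coveringGraph.branchPath bc vc h').hom.app ((A.vertexHom vc).pullback.obj (A.vComp vc).1)
        ((A.coveringGraph.fibE (A.fibreData.total.edgeOf bc)).map
          ((A.twoIsoCan bc vc h').inv.app ((A.vComp vc).1 : ℋ.V (A.fibreData.proj.vertexMap vc)))
          ((A.coveringGraph.fibE (A.fibreData.total.edgeOf bc)).map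
            ((A.edgeHom (A.fibreData.total.edgeOf bc)).pullback.map
              (A.inclOfLE (abuts_fst h') (A.vComp vc).1 (A.brComp bc).1 (brComp_le_branchImage h')))
            ((A.coveringGraph.fibE (A.fibreData.total.edgeOf bc)).map
              ((A.eE (A.fibreData.total.edgeOf bc)).functor.map (diagSection _))
              (A.tE (A.fibreData.total.edgeOf bc))))) =
      (A.coveringGraph.fibV vc).map ((A.eV vc).functor.map (diagSection _)) (A.tV vc) :=
  A.alignIso_point bc vc h' (A.coveringGraph.fibV vc) (A.coveringGraph.fibE (A.fibreData.total.edgeOf bc))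
    (A.coveringGraph.branchPath bc vc h') (A.tV vc) (A.tE (A.fibreData.total.edgeOf bc))

/-- **(PS3), the point clause, for print's constructed covering**: the aligned conjugator carries the
glued canonical edge point to the canonical vertex point, `conjCan · glue_b(zCan) = yCan`.  Mechanism:
`conjCan` acts by transporting back along the paths of `ℋ` (undoing the gluing of `toCovObj A` and the
path in `zCan`), across the 2-cell `φ_b⁻¹` of `coveringHomCan` and forth along the paths of `𝒢_A`,
where L4-t17's point alignment (`alignIso_point`: one-point fibres of `P = P`, `Q = Q`) identifies the
result with the point in `yCan`; the remaining steps are naturality along `P ↪ S_v`.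
[cite: MochizukiSemiAnbd2006, Def. 2.2(i) p.23] -/
theorem ρ_conjCan_glue_zCan :
    ((toCovObj A).SV (A.fibreData.proj.vertexMap vc)).obj.ρ (A.conjCan bc vc h')
        (((toCovObj A).glue (A.fibreData.proj.branchMap bc) (A.fibreData.proj.vertexMap vc)
          (abuts_fst h')).hom.hom.hom (A.zCan (A.fibreData.total.edgeOf bc))) =
      A.yCan vc := by
  have key : ∀ u : (ℋ.fibV (A.fibreData.proj.vertexMap vc)).obj (A.S (A.fibreData.proj.vertexMap vc)),
      ((toCovObj A).SV (A.fibreData.proj.vertexMap vc)).obj.ρ (A.conjCan bc vc h') u =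
        A.conjCan bc vc h' • u := fun u => rfl
  -- the canonical edge point, with the edge path at the presentation used by the 2-cell
  have hz : A.zCan (A.fibreData.total.edgeOf bc) =
      (ℋ.fibE _).map (A.brComp bc).1.arrow
        ((A.coveringHomCan.over.edgePath (A.fibreData.total.edgeOf bc)
            (ℋ.graph.edgeOf (A.fibreData.proj.branchMap bc)) (A.fibreData.proj.edgeOf_branchMap bc).symm).hom.app _
          ((A.coveringGraph.fibE (A.fibreData.total.edgeOf bc)).map
            ((A.eE (A.fibreData.total.edgeOf bc)).functor.map
              ((Over.forgetAdjStar _).unit.app (Over.mk (𝟙 _)))) (A.tE (A.fibreData.total.edgeOf bc)))) :=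
    rfl
  rw [toCovObj_glue_apply, key, conjCan]
  erw [HomOver.conjOfPaths_smul]
  -- undo `α_ℋ`
  erw [Iso.hom_inv_id_app_apply]
  -- `F_e(ψ⁻¹)(zCan) = γ_e((E ⋙ F_e')(ι ≫ b^*(P ↪ S)) m)`
  rw [hz]
  erw [← FintypeCat.comp_apply (f := (ℋ.fibE _).map (A.brComp bc).1.arrow)]
  rw [← Functor.map_comp, A.brComp_arrow_comp_ψ_inv bc vc h']
  -- naturality of `γ_e`, then undo `γ_e`
  erw [← NatTrans.naturality_apply
    (A.coveringHomCan.over.edgePath (A.fibreData.total.edgeOf bc)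
      (ℋ.graph.edgeOf (A.fibreData.proj.branchMap bc)) (A.fibreData.proj.edgeOf_branchMap bc).symm).hom]
  erw [Iso.hom_inv_id_app_apply]
  -- split `ι ≫ b^*(P ↪ S)` and cross the 2-cell `φ_b⁻¹` (naturality along `P ↪ S`)
  rw [Functor.map_comp, FintypeCat.comp_apply]
  erw [NatTrans.naturality_apply
    (Functor.whiskerRight (A.coveringHomCan.over.φB bc vc h').inv
      (A.coveringGraph.fibE (A.fibreData.total.edgeOf bc))) (A.vComp vc).1.arrow]
  -- naturality of `α_𝒢` along `ψ_{vc}^*(P ↪ S)`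
  erw [NatTrans.naturality_apply (A.coveringGraph.branchPath bc vc h').hom
    ((A.coveringHomCan.over.φV vc).pullback.map (A.vComp vc).1.arrow)]
  -- L4-t17's point alignment (one-point fibres)
  rw [← diagSection_eq_unit]
  erw [A.alignIso_point_can bc vc h']
  -- naturality of `γ_v` along `P ↪ S`, and the definition of `yCan`
  erw [NatTrans.naturality_apply (A.coveringHomCan.over.vertexPath vc).hom (A.vComp vc).1.arrow]
  rw [yCan, ← diagSection_eq_unit]
  rfl


/-- **(PS3) for print's constructed covering** at the canonical points: the squares of
`ψ.toProfinite` commute up to the aligned conjugators `conjCan`, which carry the glued canonical edge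
points to the canonical vertex points. [cite: MochizukiSemiAnbd2006, Def. 2.2(i) p.23] -/
theorem pointAligned_can : (toCovObj A).PointAligned A.coveringHomCan.toProfinite A.yCan A.zCan :=
  ⟨fun bc vc h' => ⟨A.conjCan bc vc h', fun x => A.hV_brHom_eq_conjCan bc vc h' x,
    A.ρ_conjCan_glue_zCan bc vc h'⟩⟩

end PointAlignment

/-! ### The isomorphism over the base and the tempered covering -/

/-- **Print's constructed covering `𝒢_A → ℋ`, read on profinite presentations, is ISOMORPHIC OVER
`ℋ` to the covering `𝒢_S → ℋ` of the finite object `S = toCovObj A` of `B^cov(ℋ)`** (Def. 2.2 (i) ↔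
Def. 3.5 (i): "coverings of semi-graphs of anabelioids that arise from finite objects of `B^cov(G)`
determine 'finite étale coverings'") — `CovObj.pointIsoOver` at the canonical point system.
[cite: MochizukiSemiAnbd2006, Def 3.5(i) p.37] -/
def isoOverCan : ProfiniteSemiGraph.Hom.IsoOver A.coveringHomCan.toProfinite (toCovObj A).coveringHom :=
  (toCovObj A).pointIsoOver A.coveringHomCan.toProfinite A.yCan A.zCan A.glueCondition_can
    A.stabCondition_can A.pointAligned_can A.isProper_can A.pointLift_vertexMap_bijective_can
    A.pointLift_edgeMap_bijective_can

/-- For `ℋ` connected and countable, `toCovObj A` is a TEMPERED object of `B^cov(ℋ)` (it is finite: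
abc-iut-L3-t2/t9's `FiniteIsTempered_holds`, "`B(G) ↪ B^temp(G)`", Def. 3.5 (ii) p. 37).
[cite: MochizukiSemiAnbd2006, Def 3.5(ii) p.37] -/
theorem isTempered_toCovObj (hc : ℋ.graph.IsConnected) (hκ : ℋ.graph.IsCountable) :
    (toCovObj A).IsTempered :=
  ProfiniteSemiGraph.FiniteIsTempered_holds ℋ.toProfinite hc hκ _ (toCovObj_isFinite A)

/-- **Print's constructed covering is a TEMPERED COVERING on profinite presentations**: for `ℋ`
connected and countable there is a tempered object `S` of `B^cov(ℋ)` (namely `toCovObj A`) with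
`𝒢_A ≅ 𝒢_S` over `ℋ` — the body of `SgA.IsTemperedCoveringVia` for the 1-morphism `coveringHomCan A`.
[cite: MochizukiSemiAnbd2006, Def 3.5(ii) p.37] -/
theorem exists_isTempered_isoOver_can (hc : ℋ.graph.IsConnected) (hκ : ℋ.graph.IsCountable) :
    ∃ S : ProfiniteSemiGraph.CovObj ℋ.toProfinite, S.IsTempered ∧
      Nonempty (ProfiniteSemiGraph.Hom.IsoOver A.coveringHomCan.toProfinite S.coveringHom) :=
  ⟨toCovObj A, A.isTempered_toCovObj hc hκ, ⟨A.isoOverCan⟩⟩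

end BObj

end SemiGraphOfAnabelioids

end Literature.AnabelianGeometry.SemiGraphs

end
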